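import Mathlib
import HarnessLib
import Summits.Ventures.LatticeQCDFlow.Exactness.SphereLOFlowESSCeiling
import Summits.Ventures.LatticeQCDFlow.Exactness.SphereLOCarrePairConditionalVariance
import Summits.Ventures.LatticeQCDFlow.Exactness.TorusConeGeometry
import Summits.Ventures.LatticeQCDFlow.Exactness.TorusLinkCouplingHypotheses
import Summits.Ventures.LatticeQCDFlow.Exactness.TorusSublatticeLinks

/-!
# The second-moment barrier in closed form: for the link-transported CP(N−1)/O(N) coupling on `(ℤ/L)^ν`, `L = s·q ≥ 4`, `s ≥ 4m+6`, and every power `t ≥ 0` of the importance weights, `(∫w^t dπ̄)²·exp(q^ν·θ_t(c)) ≤ e^{4tL^ν δ₁(c)}·∫w^{2t} dπ̄` — at `t = 1` the ESS fraction of the uncorrected exact LO flow sampler is `≤ exp(−L^ν(θ₁(c)/s^ν − 4δ₁(c)))`, EXPONENTIALLY SMALL IN THE VOLUME at fixed small flow time; `t = 1/2` feeds the acceptance barrier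

HONEST FRAMING: exact (Metropolis-corrected) sampling algorithms for lattice gauge theory;
figures of merit are autocorrelation/cost numbers at stated couplings and volumes; no
continuum-physics claim.

Venture `LatticeQCDFlow` (cell pub-lqcd), topic `Exactness`; FANOUT row 7 (`s0-cpn-null`).  NEW WORK of
the cell over this lineage's `Exactness/SphereLOFlowESSCeiling.lean` (the second-moment barrier for the
powers `w^t` of the weights, blocks with pairwise disjoint cone neighbourhoods),
`Exactness/SphereLOCarrePairConditionalVariance.lean` (the pair variance `32κ⁴β⁴/((d−1)d²(d+2))`),
`Exactness/TorusConeGeometry.lean` (sup-boxes, `nball ⊆ Box`, `|I_j| ≤ |B_j|(2m+3)^ν`,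
triangle-freeness), `Exactness/TorusLinkCouplingHypotheses.lean` (the torus link coupling inhabits every
coupling hypothesis, `υ = 2ν`, `β₀ = 1`) and `Exactness/TorusSublatticeLinks.lean` (the `q^ν` sublattice
links are box-apart); nothing is cited as a fact.  Printed counterparts, NAMED ONLY: Engel–Schaefer 2011
§3; Lüscher 2010; Abbott et al., Phys. Rev. D 106 (2022) 074506, §V item 4 ("for fixed models the
effective sample size degrades exponentially in volume").  THE SAMPLER-QUALITY BARRIER AS A THEOREM FOR
THE MODEL OF RECORD: with `θ_t(c) = e^{−4tM₀}·t²·(max 0 ((c⁴/8)·32κ⁴/((d−1)d²(d+2)) − 4ρ₀²))/(1 + (tM₀)²)`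
(`M₀ = 2I₀κ²(2ν)²c²/(d−1)`, `ρ₀ = I₀(4|κ|³(2ν)³/(d−1)²)c³`, `I₀ = 2(2m+3)^ν`) and
`δ₁(c) = (6κ²(2ν)²/(d−1))c²·2e^{Kc}(Kc)^{m+1}/(m+1)!` (`K = 6|κ|ν/(d−1)`), the importance weights
`w = exp(ℓ_{0→c} − c·S∘Φ_{0→c})` of the uncorrected exact leading-order trivializing flow sampler satisfy,
for every `t ≥ 0`, `(∫w^t dπ̄)²·exp(q^ν·θ_t(c)) ≤ exp(4tL^ν·δ₁(c))·∫w^{2t} dπ̄`.  At `t = 1`: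
`ESS/N ≤ exp(−L^ν·(θ₁(c)/s^ν − 4δ₁(c)))`, where `θ₁(c) ≍ c⁴` and `δ₁(c) ≍ c^{m+3}`: for `m ≥ 2` and every
fixed sufficiently small `c` the effective sample size is EXPONENTIALLY SMALL IN THE VOLUME (the tree's
GEN-15 floor is `exp(−(c²/2)M)`, `M ∝ L^ν`: both directions are in the tree); at `t = 1/2` the left
side dominates the mean Metropolis acceptance of the flow-based independence sampler (sequel
`Exactness/TorusLinkAcceptanceCeiling.lean`).

## Content

* `blocks_ballDisjoint_of_box_apart` — blocks pairwise `Box(4(m+1))`-apart have pairwise disjoint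
  radius-`(m+1)` cone neighbourhoods (every two balls meeting different blocks are disjoint);
* `essBlockTerm_antitone` — the block term `e^{−4M(I)}(max 0 (X − 4(Iρ')²))/(1 + M(I)²)`,
  `M(I) = 2Iμ'`, is antitone in `I ≥ 0`; `essBlockTerm_pow_antitone` — the same for
  `e^{−4tM(I)}·t²(max 0 (X − 4(Iρ')²))/(1 + (tM(I))²)`, `t ≥ 0`;
* **`torusLink_sublattice_sq_integral_loWeight_pow_le`** — the displayed inequality for every `t ≥ 0`;
* **`torusLink_sublattice_sq_integral_loWeight_le`** — its `t = 1` instance (the ESS barrier).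

NOT CLAIMED: optimal constants; `L ≤ 3`, `s ∤ L`; autocorrelations of the Metropolis-corrected chain;
numbers.
-/

noncomputable section

namespace Summit.Ventures.LatticeQCDFlow.Exactness

open Function Set Metric MeasureTheory NormedSpace InnerProductSpace InformationTheory
  Literature.MathematicalPhysics.QuantumFieldTheory
open scoped RealInnerProductSpace Topology Nat Classical

/-! ## §1 Two combinatorial/elementary inputs -/

section Inputs

variable {ν L : ℕ} [NeZero L] {E : Type*} [NormedAddCommGroup E] [InnerProductSpace ℝ E]
  {U : Site ν L → Site ν L → (E →L[ℝ] E)}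

omit [NeZero L] in
/-- **Blocks pairwise `Box(4(m+1))`-apart have pairwise disjoint cone neighbourhoods**: any two
radius-`(m+1)` balls meeting different blocks are disjoint (nearest-neighbour couplings). -/
theorem blocks_ballDisjoint_of_box_apart
    (hNN : ∀ x y, U x y ≠ 0 → ∃ i : Fin ν, y = x.shift i ∨ x = y.shift i) (m : ℕ)
    {J : Type*} (Tb : Finset J) (B : J → Finset (Site ν L))
    (hapart : ∀ j ∈ Tb, ∀ j' ∈ Tb, j ≠ j' → ∀ b ∈ B j, ∀ b' ∈ B j',
      b' ∉ (Fintype.piFinset fun _ : Fin ν =>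
          Finset.Icc (-((m + 1 + (m + 1) + (m + 1 + (m + 1)) : ℕ) : ℤ))
            ((m + 1 + (m + 1) + (m + 1 + (m + 1)) : ℕ) : ℤ)).image
        (fun v : Fin ν → ℤ => b + fun i => ((v i : ℤ) : ZMod L))) :
    ∀ n n', ∀ j ∈ Tb, ∀ j' ∈ Tb, j ≠ j' →
      ¬ Disjoint (nball (fun k => insert k (couplingNbhd U k)) (m + 1) n) (↑(B j) : Set (Site ν L)) →
      ¬ Disjoint (nball (fun k => insert k (couplingNbhd U k)) (m + 1) n') (↑(B j') : Set (Site ν L)) →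
      Disjoint (nball (fun k => insert k (couplingNbhd U k)) (m + 1) n)
        (nball (fun k => insert k (couplingNbhd U k)) (m + 1) n') := by
  intro n n' j hj j' hj' hne h1 h2
  rw [Set.disjoint_left]
  intro x hx hx'
  obtain ⟨b, hbn, hbB⟩ := Set.not_disjoint_iff.1 h1
  obtain ⟨b', hb'n, hb'B⟩ := Set.not_disjoint_iff.1 h2
  -- b ~ n ~ x ~ n' ~ b' : four boxes of radius m+1
  have hnb : n ∈ (Fintype.piFinset fun _ : Fin ν => Finset.Icc (-((m + 1 : ℕ) : ℤ)) ((m + 1 : ℕ) : ℤ)).image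
      (fun v : Fin ν → ℤ => b + fun i => ((v i : ℤ) : ZMod L)) :=
    torus_mem_box_comm.1 (torus_nball_subset_box hNN n (m + 1) hbn)
  have hxn := torus_nball_subset_box hNN n (m + 1) hx
  have hn'x : n' ∈ (Fintype.piFinset fun _ : Fin ν => Finset.Icc (-((m + 1 : ℕ) : ℤ)) ((m + 1 : ℕ) : ℤ)).image
      (fun v : Fin ν → ℤ => x + fun i => ((v i : ℤ) : ZMod L)) :=
    torus_mem_box_comm.1 (torus_nball_subset_box hNN n' (m + 1) hx')
  have hb'n' := torus_nball_subset_box hNN n' (m + 1) hb'n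
  have hxb := torus_mem_box_add hnb hxn
  have hb'x := torus_mem_box_add hn'x hb'n'
  exact hapart j hj j' hj' hne b hbB b' hb'B (torus_mem_box_add hxb hb'x)

omit [NeZero L] in
/-- **The ESS block term is antitone in the cone-neighbourhood size**: for `0 ≤ I ≤ I₀`, `0 ≤ μ'`,
`e^{−4(2I₀μ')}(max 0 (X − 4(I₀ρ')²))/(1 + (2I₀μ')²) ≤ e^{−4(2Iμ')}(max 0 (X − 4(Iρ')²))/(1 + (2Iμ')²)`. -/
theorem essBlockTerm_antitone {I I₀ μ' ρ' X : ℝ} (hI0 : 0 ≤ I) (hI : I ≤ I₀) (hμ : 0 ≤ μ') :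
    Real.exp (-4 * (2 * (I₀ * μ'))) * (max 0 (X - 4 * (I₀ * ρ') ^ 2)) / (1 + (2 * (I₀ * μ')) ^ 2) ≤
      Real.exp (-4 * (2 * (I * μ'))) * (max 0 (X - 4 * (I * ρ') ^ 2)) / (1 + (2 * (I * μ')) ^ 2) := by
  have hI0' : 0 ≤ I₀ := hI0.trans hI
  have h1 : Real.exp (-4 * (2 * (I₀ * μ'))) ≤ Real.exp (-4 * (2 * (I * μ'))) :=
    Real.exp_le_exp.2 (by nlinarith [mul_le_mul_of_nonneg_right hI hμ])
  have hsq : (I * ρ') ^ 2 ≤ (I₀ * ρ') ^ 2 := by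
    rw [mul_pow, mul_pow]; exact mul_le_mul_of_nonneg_right (pow_le_pow_left₀ hI0 hI 2) (sq_nonneg _)
  have h2 : max 0 (X - 4 * (I₀ * ρ') ^ 2) ≤ max 0 (X - 4 * (I * ρ') ^ 2) :=
    max_le_max le_rfl (by linarith)
  have hsqμ : (2 * (I * μ')) ^ 2 ≤ (2 * (I₀ * μ')) ^ 2 :=
    pow_le_pow_left₀ (by positivity) (by nlinarith [mul_le_mul_of_nonneg_right hI hμ]) 2
  have h3 : 1 + (2 * (I * μ')) ^ 2 ≤ 1 + (2 * (I₀ * μ')) ^ 2 := by linarith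
  calc Real.exp (-4 * (2 * (I₀ * μ'))) * (max 0 (X - 4 * (I₀ * ρ') ^ 2)) / (1 + (2 * (I₀ * μ')) ^ 2)
      ≤ Real.exp (-4 * (2 * (I * μ'))) * (max 0 (X - 4 * (I * ρ') ^ 2)) / (1 + (2 * (I₀ * μ')) ^ 2) :=
        div_le_div_of_nonneg_right (mul_le_mul h1 h2 (le_max_left _ _) (Real.exp_pos _).le) (by positivity)
    _ ≤ Real.exp (-4 * (2 * (I * μ'))) * (max 0 (X - 4 * (I * ρ') ^ 2)) / (1 + (2 * (I * μ')) ^ 2) :=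
        div_le_div_of_nonneg_left (mul_nonneg (Real.exp_pos _).le (le_max_left _ _)) (by positivity) h3


omit [NeZero L] in
/-- The same for the block term of the power `t ≥ 0` of the weights:
`e^{−4t(2I₀μ')}·t²(max 0 (X − 4(I₀ρ')²))/(1 + (t·2I₀μ')²) ≤ e^{−4t(2Iμ')}·t²(max 0 (X − 4(Iρ')²))/(1 + (t·2Iμ')²)`
for `0 ≤ I ≤ I₀` (the case `μ' ↦ tμ'` of `essBlockTerm_antitone`, times `t²`). -/
theorem essBlockTerm_pow_antitone {I I₀ μ' ρ' X t : ℝ} (hI0 : 0 ≤ I) (hI : I ≤ I₀) (hμ : 0 ≤ μ')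
    (ht : 0 ≤ t) :
    Real.exp (-4 * (t * (2 * (I₀ * μ')))) * (t ^ 2 * max 0 (X - 4 * (I₀ * ρ') ^ 2)) /
        (1 + (t * (2 * (I₀ * μ'))) ^ 2) ≤
      Real.exp (-4 * (t * (2 * (I * μ')))) * (t ^ 2 * max 0 (X - 4 * (I * ρ') ^ 2)) /
        (1 + (t * (2 * (I * μ'))) ^ 2) := by
  have h := essBlockTerm_antitone (μ' := t * μ') (ρ' := ρ') (X := X) hI0 hI (mul_nonneg ht hμ)
  have e1 : ∀ K : ℝ, t * (2 * (K * μ')) = 2 * (K * (t * μ')) := fun K => by ring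
  have e2 : ∀ K : ℝ, Real.exp (-4 * (2 * (K * (t * μ')))) * (t ^ 2 * max 0 (X - 4 * (K * ρ') ^ 2)) /
        (1 + (2 * (K * (t * μ'))) ^ 2) =
      t ^ 2 * (Real.exp (-4 * (2 * (K * (t * μ')))) * max 0 (X - 4 * (K * ρ') ^ 2) /
        (1 + (2 * (K * (t * μ'))) ^ 2)) := fun K => by ring
  rw [e1, e1, e2, e2]
  exact mul_le_mul_of_nonneg_left h (sq_nonneg t)

end Inputs

/-! ## §2 The second-moment barrier for the model of record -/

section Torus

variable {ν L : ℕ} [NeZero L] {E : Type*} [NormedAddCommGroup E] [InnerProductSpace ℝ E]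
  [FiniteDimensional ℝ E] [MeasurableSpace E] [BorelSpace E] [Nontrivial E] {T : ℝ}

set_option maxHeartbeats 400000 in
/-- **THE SECOND-MOMENT BARRIER FOR THE LINK-TRANSPORTED CP(N−1)/O(N) COUPLING ON `(ℤ/L)^ν`.**
Arbitrary link isometries `R`; `L = s·q ≥ 4`, `s ≥ 4m+6`, a direction `i₀`, `d = dim E ≥ 2`,
`0 ≤ c ≤ |T| + 1`, `t ≥ 0`; `w = exp(ℓ_{0→c} − c·S∘Φ_{0→c})` the importance weights of the uncorrected
exact LO flow sampler.  Then `(∫w^t dπ̄)²·exp(q^ν·θ_t(c)) ≤ exp(4t·L^ν·δ₁(c))·∫w^{2t} dπ̄` with `θ_t`, `δ₁`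
as in the header. -/
theorem torusLink_sublattice_sq_integral_loWeight_pow_le {s q : ℕ} (hL : 4 ≤ L) (hLsq : L = s * q)
    (R : Site ν L × Fin ν → (E ≃ₗᵢ[ℝ] E))
    (hd : 2 ≤ Module.finrank ℝ E) (κ S₀ : ℝ)
    {c : ℝ} (hc0 : 0 ≤ c) (hc : c ≤ |T| + 1) {e : Site ν L → E} (he : ∀ n, ‖e n‖ = 1) (m : ℕ)
    {g : Site ν L → (Site ν L → sphere (0 : E) 1) → ℝ}
    (hg : ∀ n ω, g n ω = -∫ u in (0 : ℝ)..c, u * (2 * κ ^ 2 / ((Module.finrank ℝ E : ℝ) - 1) *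
      ‖tangentKick (localField (linkCoupling (fun ℓ : Site ν L × Fin ν => ℓ.1) (fun ℓ => ℓ.1.shift ℓ.2) R) n
        (sphereTDFlow (G := fun _ : ℝ => loFlowAction κ S₀
          (linkCoupling (fun ℓ : Site ν L × Fin ν => ℓ.1) (fun ℓ => ℓ.1.shift ℓ.2) R))
          (contDiff_const_family (contDiff_loFlowAction
            (linkCoupling (fun ℓ : Site ν L × Fin ν => ℓ.1) (fun ℓ => ℓ.1.shift ℓ.2) R) κ S₀)) T 0 u
          ((nball (fun k => insert k (couplingNbhd
            (linkCoupling (fun ℓ : Site ν L × Fin ν => ℓ.1) (fun ℓ => ℓ.1.shift ℓ.2) R) k)) (m + 1) n).piecewise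
            (fun i => ((ω i : sphere (0 : E) 1) : E)) e)))
        (sphereTDFlow (G := fun _ : ℝ => loFlowAction κ S₀
          (linkCoupling (fun ℓ : Site ν L × Fin ν => ℓ.1) (fun ℓ => ℓ.1.shift ℓ.2) R))
          (contDiff_const_family (contDiff_loFlowAction
            (linkCoupling (fun ℓ : Site ν L × Fin ν => ℓ.1) (fun ℓ => ℓ.1.shift ℓ.2) R) κ S₀)) T 0 u
          ((nball (fun k => insert k (couplingNbhd
            (linkCoupling (fun ℓ : Site ν L × Fin ν => ℓ.1) (fun ℓ => ℓ.1.shift ℓ.2) R) k)) (m + 1) n).piecewise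
            (fun i => ((ω i : sphere (0 : E) 1) : E)) e) n)‖ ^ 2))
    (i₀ : Fin ν) (hs4 : m + 1 + (m + 1) + (m + 1 + (m + 1)) + 2 ≤ s) {t : ℝ} (ht : 0 ≤ t) :
    (∫ ω, Real.exp (t * (sphereTDFlowLogJac (G := fun _ : ℝ => loFlowAction κ S₀
            (linkCoupling (fun ℓ : Site ν L × Fin ν => ℓ.1) (fun ℓ => ℓ.1.shift ℓ.2) R))
          (contDiff_const_family (contDiff_loFlowAction
            (linkCoupling (fun ℓ : Site ν L × Fin ν => ℓ.1) (fun ℓ => ℓ.1.shift ℓ.2) R) κ S₀)) T 0 c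
            (fun i => ((ω : Site ν L → sphere (0 : E) 1) i : E)) -
          c * esAction κ S₀ (linkCoupling (fun ℓ : Site ν L × Fin ν => ℓ.1) (fun ℓ => ℓ.1.shift ℓ.2) R)
            (sphereTDFlow (G := fun _ : ℝ => loFlowAction κ S₀
              (linkCoupling (fun ℓ : Site ν L × Fin ν => ℓ.1) (fun ℓ => ℓ.1.shift ℓ.2) R))
            (contDiff_const_family (contDiff_loFlowAction
              (linkCoupling (fun ℓ : Site ν L × Fin ν => ℓ.1) (fun ℓ => ℓ.1.shift ℓ.2) R) κ S₀)) T 0 c (fun i => (ω i : E)))))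
        ∂Measure.pi (fun _ : Site ν L => uniformSphere (volume : Measure E))) ^ 2 *
      Real.exp ((q : ℝ) ^ ν * (Real.exp (-4 * (t * (2 * ((2 * (2 * ((m : ℝ) + 1) + 1) ^ ν) * (κ ^ 2 * (2 * (ν : ℝ)) ^ 2 / ((Module.finrank ℝ E : ℝ) - 1) * c ^ 2))))) *
        (t ^ 2 * max 0 (c ^ 4 / 8 * (32 * κ ^ 4 /
          (((Module.finrank ℝ E : ℝ) - 1) * (Module.finrank ℝ E : ℝ) ^ 2 * ((Module.finrank ℝ E : ℝ) + 2))) -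
          4 * ((2 * (2 * ((m : ℝ) + 1) + 1) ^ ν) * (4 * |κ| ^ 3 * (2 * (ν : ℝ)) ^ 3 / ((Module.finrank ℝ E : ℝ) - 1) ^ 2 * c ^ 3)) ^ 2)) / (1 + (t * (2 * ((2 * (2 * ((m : ℝ) + 1) + 1) ^ ν) * (κ ^ 2 * (2 * (ν : ℝ)) ^ 2 / ((Module.finrank ℝ E : ℝ) - 1) * c ^ 2)))) ^ 2))) ≤
      Real.exp (4 * (t * ((L : ℝ) ^ ν * (6 * κ ^ 2 * (2 * (ν : ℝ)) ^ 2 / ((Module.finrank ℝ E : ℝ) - 1) * c ^ 2 *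
        (2 * Real.exp (3 * |κ| * (2 * (ν : ℝ)) / ((Module.finrank ℝ E : ℝ) - 1) * c) *
          (3 * |κ| * (2 * (ν : ℝ)) / ((Module.finrank ℝ E : ℝ) - 1) * c) ^ (m + 1) / ((m + 1)! : ℝ)))))) *
      ∫ ω, Real.exp (t * (sphereTDFlowLogJac (G := fun _ : ℝ => loFlowAction κ S₀
            (linkCoupling (fun ℓ : Site ν L × Fin ν => ℓ.1) (fun ℓ => ℓ.1.shift ℓ.2) R))
          (contDiff_const_family (contDiff_loFlowAction
            (linkCoupling (fun ℓ : Site ν L × Fin ν => ℓ.1) (fun ℓ => ℓ.1.shift ℓ.2) R) κ S₀)) T 0 c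
            (fun i => ((ω : Site ν L → sphere (0 : E) 1) i : E)) -
          c * esAction κ S₀ (linkCoupling (fun ℓ : Site ν L × Fin ν => ℓ.1) (fun ℓ => ℓ.1.shift ℓ.2) R)
            (sphereTDFlow (G := fun _ : ℝ => loFlowAction κ S₀
              (linkCoupling (fun ℓ : Site ν L × Fin ν => ℓ.1) (fun ℓ => ℓ.1.shift ℓ.2) R))
            (contDiff_const_family (contDiff_loFlowAction
              (linkCoupling (fun ℓ : Site ν L × Fin ν => ℓ.1) (fun ℓ => ℓ.1.shift ℓ.2) R) κ S₀)) T 0 c (fun i => (ω i : E))))) ^ 2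
        ∂Measure.pi (fun _ : Site ν L => uniformSphere (volume : Measure E)) := by
  have hL3 : 3 ≤ L := by omega
  have hL3' : L ≠ 3 := by omega
  have hd1 : (0 : ℝ) < (Module.finrank ℝ E : ℝ) - 1 := by
    have : (2 : ℝ) ≤ Module.finrank ℝ E := by exact_mod_cast hd
    linarith
  -- the model of record inhabits the hypotheses
  have hU0 := torusLink_self R hL3
  have hUadj : ∀ m n (v w : E),
      ⟪(linkCoupling (fun ℓ : Site ν L × Fin ν => ℓ.1) (fun ℓ => ℓ.1.shift ℓ.2) R) m n v, w⟫ =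
        ⟪v, (linkCoupling (fun ℓ : Site ν L × Fin ν => ℓ.1) (fun ℓ => ℓ.1.shift ℓ.2) R) n m w⟫ :=
    fun m n v w => inner_linkCoupling _ _ R m n v w
  have hNN := torusLink_ne_zero_imp_nn (ν := ν) (L := L) R
  have hβ : ∀ n m (v : E),
      ‖(linkCoupling (fun ℓ : Site ν L × Fin ν => ℓ.1) (fun ℓ => ℓ.1.shift ℓ.2) R) n m v‖ =
        (fun n m : Site ν L => if ∃ i : Fin ν, m = n.shift i ∨ n = m.shift i then (1 : ℝ) else 0) n m * ‖v‖ :=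
    fun n m v => norm_torusLink_apply R hL3 n m v
  have hυ := sum_norm_torusLink_le R hL3
  have hsym : ∀ x y, (linkCoupling (fun ℓ : Site ν L × Fin ν => ℓ.1) (fun ℓ => ℓ.1.shift ℓ.2) R) x y ≠ 0 →
      (linkCoupling (fun ℓ : Site ν L × Fin ν => ℓ.1) (fun ℓ => ℓ.1.shift ℓ.2) R) y x ≠ 0 := by
    intro x y hxy hyx
    apply hxy
    ext v
    have h0 : ∀ w', ⟪(linkCoupling (fun ℓ : Site ν L × Fin ν => ℓ.1) (fun ℓ => ℓ.1.shift ℓ.2) R) x y v, w'⟫ = 0 := fun w' => by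
      rw [hUadj x y v w', hyx]; simp
    simpa using h0 ((linkCoupling (fun ℓ : Site ν L × Fin ν => ℓ.1) (fun ℓ => ℓ.1.shift ℓ.2) R) x y v)
  -- the pair blocks of the sublattice family
  set xf : (Fin ν → Fin q) → Site ν L := fun a i => (((s * (a i : ℕ) : ℕ) : ℤ) : ZMod L) with hxf
  set B : (Fin ν → Fin q) → Finset (Site ν L) := fun a => {xf a, (xf a).shift i₀} with hBdef
  have hcoupled : ∀ a, (linkCoupling (fun ℓ : Site ν L × Fin ν => ℓ.1) (fun ℓ => ℓ.1.shift ℓ.2) R) (xf a) ((xf a).shift i₀) ≠ 0 := by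
    intro a h
    obtain ⟨v, hv⟩ := exists_ne (0 : E)
    have h1 := congrArg (fun A : E →L[ℝ] E => A v) h
    simp only [zero_apply] at h1
    rw [torusLink_apply_shift R hL3] at h1
    have hn := (R (xf a, i₀)).symm.norm_map v
    rw [h1, norm_zero] at hn
    exact hv (norm_eq_zero.1 hn.symm)
  have hkl : ∀ a, xf a ≠ (xf a).shift i₀ := fun a h => hcoupled a (by rw [← h]; exact hU0 _)
  have hapart4 := fun (a : Fin ν → Fin q) (_ : a ∈ (Finset.univ : Finset (Fin ν → Fin q)))
      (a' : Fin ν → Fin q) (_ : a' ∈ (Finset.univ : Finset (Fin ν → Fin q))) (haa : a ≠ a') =>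
    torus_sublattice_links_box_apart (R := m + 1 + (m + 1) + (m + 1 + (m + 1))) hLsq hs4 i₀ haa
  have hsep2 := blocks_ballDisjoint_of_box_apart (U := (linkCoupling (fun ℓ : Site ν L × Fin ν => ℓ.1) (fun ℓ => ℓ.1.shift ℓ.2) R))
    hNN m Finset.univ B hapart4
  -- one pair per block: `Pf a = {B a}`
  have hP : ∀ a ∈ (Finset.univ : Finset (Fin ν → Fin q)), ∀ P ∈ ({B a} : Finset (Finset (Site ν L))),
      ∀ P' ∈ ({B a} : Finset (Finset (Site ν L))), P ≠ P' → Disjoint P P' := by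
    intro a _ P hP P' hP' hne
    rw [Finset.mem_singleton] at hP hP'
    exact absurd (hP.trans hP'.symm) hne
  have hPC : ∀ a ∈ (Finset.univ : Finset (Fin ν → Fin q)), ∀ P ∈ ({B a} : Finset (Finset (Site ν L))),
      Disjoint P (Finset.univ \ (Finset.univ : Finset (Fin ν → Fin q)).biUnion B) := by
    intro a ha P hP
    rw [Finset.mem_singleton] at hP
    subst hP
    rw [Finset.disjoint_left]
    intro b hb hb'
    rw [Finset.mem_sdiff] at hb'
    exact hb'.2 (Finset.mem_biUnion.2 ⟨a, ha, hb⟩)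
  have hmain := sq_integral_loWeight_pow_mul_exp_le hU0 hUadj hd κ S₀ hυ hc0 hc he m hg Finset.univ B hsep2
    (fun a => {B a}) hP hPC (T := T) ht
  -- the exponent: each block term is at least `θ₀`, and there are `q^ν` blocks
  have hw0 : 0 ≤ (∫ ω, Real.exp (t * (sphereTDFlowLogJac (G := fun _ : ℝ => loFlowAction κ S₀
            (linkCoupling (fun ℓ : Site ν L × Fin ν => ℓ.1) (fun ℓ => ℓ.1.shift ℓ.2) R))
          (contDiff_const_family (contDiff_loFlowAction
            (linkCoupling (fun ℓ : Site ν L × Fin ν => ℓ.1) (fun ℓ => ℓ.1.shift ℓ.2) R) κ S₀)) T 0 c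
            (fun i => ((ω : Site ν L → sphere (0 : E) 1) i : E)) -
          c * esAction κ S₀ (linkCoupling (fun ℓ : Site ν L × Fin ν => ℓ.1) (fun ℓ => ℓ.1.shift ℓ.2) R)
            (sphereTDFlow (G := fun _ : ℝ => loFlowAction κ S₀
              (linkCoupling (fun ℓ : Site ν L × Fin ν => ℓ.1) (fun ℓ => ℓ.1.shift ℓ.2) R))
            (contDiff_const_family (contDiff_loFlowAction
              (linkCoupling (fun ℓ : Site ν L × Fin ν => ℓ.1) (fun ℓ => ℓ.1.shift ℓ.2) R) κ S₀)) T 0 c (fun i => (ω i : E)))))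
      ∂Measure.pi (fun _ : Site ν L => uniformSphere (volume : Measure E))) ^ 2 := sq_nonneg _
  have ecard : ((L : ℕ) : ℝ) ^ ν = (Fintype.card (Site ν L) : ℝ) := by
    rw [Fintype.card_fun, ZMod.card, Fintype.card_fin]; push_cast; rfl
  rw [ecard]
  refine le_trans ?_ hmain
  refine mul_le_mul_of_nonneg_left (Real.exp_le_exp.2 ?_) hw0
  have eq : ((Finset.univ : Finset (Fin ν → Fin q)).card : ℝ) = (q : ℝ) ^ ν := by
    rw [Finset.card_univ, Fintype.card_fun, Fintype.card_fin, Fintype.card_fin]; push_cast; rfl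
  rw [← eq, ← nsmul_eq_mul]
  apply Finset.card_nsmul_le_sum
  intro a _
  -- the per-block estimate
  have hmemI : ∀ {y : Site ν L}, y ∈ B a → y ∈ Finset.univ.filter (fun n =>
      ¬ Disjoint (nball (fun k => insert k (couplingNbhd
        (linkCoupling (fun ℓ : Site ν L × Fin ν => ℓ.1) (fun ℓ => ℓ.1.shift ℓ.2) R) k)) (m + 1) n) ↑(B a)) := by
    intro y hy
    simp only [Finset.mem_filter, Finset.mem_univ, true_and, Set.not_disjoint_iff]
    exact ⟨y, self_mem_nball (m + 1) y, hy⟩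
  have hvar := variance_coordAvg_pair_loCarreBlock_eq_of_isometric hd hU0 hUadj hβ (hkl a)
    (torus_pair_no_common_neighbour hL3' _ hU0 hNN hsym (hcoupled a))
    (hmemI (by simp [hBdef])) (hmemI (by simp [hBdef])) κ
  have hex : ∃ i : Fin ν, (xf a).shift i₀ = (xf a).shift i ∨ xf a = ((xf a).shift i₀).shift i :=
    ⟨i₀, Or.inl rfl⟩
  simp only [hex, ite_true, one_pow, mul_one] at hvar
  rw [Finset.sum_singleton, hvar]
  -- the cone-neighbourhood size is at most `I₀`
  have hI : ((Finset.univ.filter (fun n =>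
      ¬ Disjoint (nball (fun k => insert k (couplingNbhd
        (linkCoupling (fun ℓ : Site ν L × Fin ν => ℓ.1) (fun ℓ => ℓ.1.shift ℓ.2) R) k)) (m + 1) n) ↑(B a))).card : ℝ) ≤
      (2 * (2 * ((m : ℝ) + 1) + 1) ^ ν) := by
    have h1 := card_coneNbhd_le (U := (linkCoupling (fun ℓ : Site ν L × Fin ν => ℓ.1) (fun ℓ => ℓ.1.shift ℓ.2) R)) hNN m (B a)
    have h2 : (B a).card ≤ 2 := Finset.card_insert_le _ _ |>.trans (by simp)
    have h3 := h1.trans (Nat.mul_le_mul_right _ h2)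
    exact_mod_cast h3
  have hμ : 0 ≤ κ ^ 2 * (2 * (ν : ℝ)) ^ 2 / ((Module.finrank ℝ E : ℝ) - 1) * c ^ 2 := by positivity
  exact essBlockTerm_pow_antitone (Nat.cast_nonneg _) hI hμ ht

set_option maxHeartbeats 400000 in
/-- **THE EFFECTIVE-SAMPLE-SIZE BARRIER FOR THE LINK-TRANSPORTED CP(N−1)/O(N) COUPLING ON `(ℤ/L)^ν`**
(`t = 1`): with the hypotheses and notation of `torusLink_sublattice_sq_integral_loWeight_pow_le`,
`(∫w dπ̄)²·exp(q^ν·θ₁(c)) ≤ exp(4·L^ν·δ₁(c))·∫w² dπ̄`. -/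
theorem torusLink_sublattice_sq_integral_loWeight_le {s q : ℕ} (hL : 4 ≤ L) (hLsq : L = s * q)
    (R : Site ν L × Fin ν → (E ≃ₗᵢ[ℝ] E))
    (hd : 2 ≤ Module.finrank ℝ E) (κ S₀ : ℝ)
    {c : ℝ} (hc0 : 0 ≤ c) (hc : c ≤ |T| + 1) {e : Site ν L → E} (he : ∀ n, ‖e n‖ = 1) (m : ℕ)
    {g : Site ν L → (Site ν L → sphere (0 : E) 1) → ℝ}
    (hg : ∀ n ω, g n ω = -∫ u in (0 : ℝ)..c, u * (2 * κ ^ 2 / ((Module.finrank ℝ E : ℝ) - 1) *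
      ‖tangentKick (localField (linkCoupling (fun ℓ : Site ν L × Fin ν => ℓ.1) (fun ℓ => ℓ.1.shift ℓ.2) R) n
        (sphereTDFlow (G := fun _ : ℝ => loFlowAction κ S₀
          (linkCoupling (fun ℓ : Site ν L × Fin ν => ℓ.1) (fun ℓ => ℓ.1.shift ℓ.2) R))
          (contDiff_const_family (contDiff_loFlowAction
            (linkCoupling (fun ℓ : Site ν L × Fin ν => ℓ.1) (fun ℓ => ℓ.1.shift ℓ.2) R) κ S₀)) T 0 u
          ((nball (fun k => insert k (couplingNbhd
            (linkCoupling (fun ℓ : Site ν L × Fin ν => ℓ.1) (fun ℓ => ℓ.1.shift ℓ.2) R) k)) (m + 1) n).piecewise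
            (fun i => ((ω i : sphere (0 : E) 1) : E)) e)))
        (sphereTDFlow (G := fun _ : ℝ => loFlowAction κ S₀
          (linkCoupling (fun ℓ : Site ν L × Fin ν => ℓ.1) (fun ℓ => ℓ.1.shift ℓ.2) R))
          (contDiff_const_family (contDiff_loFlowAction
            (linkCoupling (fun ℓ : Site ν L × Fin ν => ℓ.1) (fun ℓ => ℓ.1.shift ℓ.2) R) κ S₀)) T 0 u
          ((nball (fun k => insert k (couplingNbhd
            (linkCoupling (fun ℓ : Site ν L × Fin ν => ℓ.1) (fun ℓ => ℓ.1.shift ℓ.2) R) k)) (m + 1) n).piecewise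
            (fun i => ((ω i : sphere (0 : E) 1) : E)) e) n)‖ ^ 2))
    (i₀ : Fin ν) (hs4 : m + 1 + (m + 1) + (m + 1 + (m + 1)) + 2 ≤ s) :
    (∫ ω, Real.exp (sphereTDFlowLogJac (G := fun _ : ℝ => loFlowAction κ S₀
            (linkCoupling (fun ℓ : Site ν L × Fin ν => ℓ.1) (fun ℓ => ℓ.1.shift ℓ.2) R))
          (contDiff_const_family (contDiff_loFlowAction
            (linkCoupling (fun ℓ : Site ν L × Fin ν => ℓ.1) (fun ℓ => ℓ.1.shift ℓ.2) R) κ S₀)) T 0 c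
            (fun i => ((ω : Site ν L → sphere (0 : E) 1) i : E)) -
          c * esAction κ S₀ (linkCoupling (fun ℓ : Site ν L × Fin ν => ℓ.1) (fun ℓ => ℓ.1.shift ℓ.2) R)
            (sphereTDFlow (G := fun _ : ℝ => loFlowAction κ S₀
              (linkCoupling (fun ℓ : Site ν L × Fin ν => ℓ.1) (fun ℓ => ℓ.1.shift ℓ.2) R))
            (contDiff_const_family (contDiff_loFlowAction
              (linkCoupling (fun ℓ : Site ν L × Fin ν => ℓ.1) (fun ℓ => ℓ.1.shift ℓ.2) R) κ S₀)) T 0 c (fun i => (ω i : E))))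
        ∂Measure.pi (fun _ : Site ν L => uniformSphere (volume : Measure E))) ^ 2 *
      Real.exp ((q : ℝ) ^ ν * (Real.exp (-4 * (2 * ((2 * (2 * ((m : ℝ) + 1) + 1) ^ ν) * (κ ^ 2 * (2 * (ν : ℝ)) ^ 2 / ((Module.finrank ℝ E : ℝ) - 1) * c ^ 2)))) *
        (max 0 (c ^ 4 / 8 * (32 * κ ^ 4 /
          (((Module.finrank ℝ E : ℝ) - 1) * (Module.finrank ℝ E : ℝ) ^ 2 * ((Module.finrank ℝ E : ℝ) + 2))) -
          4 * ((2 * (2 * ((m : ℝ) + 1) + 1) ^ ν) * (4 * |κ| ^ 3 * (2 * (ν : ℝ)) ^ 3 / ((Module.finrank ℝ E : ℝ) - 1) ^ 2 * c ^ 3)) ^ 2)) / (1 + (2 * ((2 * (2 * ((m : ℝ) + 1) + 1) ^ ν) * (κ ^ 2 * (2 * (ν : ℝ)) ^ 2 / ((Module.finrank ℝ E : ℝ) - 1) * c ^ 2))) ^ 2))) ≤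
      Real.exp (4 * ((L : ℝ) ^ ν * (6 * κ ^ 2 * (2 * (ν : ℝ)) ^ 2 / ((Module.finrank ℝ E : ℝ) - 1) * c ^ 2 *
        (2 * Real.exp (3 * |κ| * (2 * (ν : ℝ)) / ((Module.finrank ℝ E : ℝ) - 1) * c) *
          (3 * |κ| * (2 * (ν : ℝ)) / ((Module.finrank ℝ E : ℝ) - 1) * c) ^ (m + 1) / ((m + 1)! : ℝ))))) *
      ∫ ω, Real.exp (sphereTDFlowLogJac (G := fun _ : ℝ => loFlowAction κ S₀
            (linkCoupling (fun ℓ : Site ν L × Fin ν => ℓ.1) (fun ℓ => ℓ.1.shift ℓ.2) R))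
          (contDiff_const_family (contDiff_loFlowAction
            (linkCoupling (fun ℓ : Site ν L × Fin ν => ℓ.1) (fun ℓ => ℓ.1.shift ℓ.2) R) κ S₀)) T 0 c
            (fun i => ((ω : Site ν L → sphere (0 : E) 1) i : E)) -
          c * esAction κ S₀ (linkCoupling (fun ℓ : Site ν L × Fin ν => ℓ.1) (fun ℓ => ℓ.1.shift ℓ.2) R)
            (sphereTDFlow (G := fun _ : ℝ => loFlowAction κ S₀
              (linkCoupling (fun ℓ : Site ν L × Fin ν => ℓ.1) (fun ℓ => ℓ.1.shift ℓ.2) R))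
            (contDiff_const_family (contDiff_loFlowAction
              (linkCoupling (fun ℓ : Site ν L × Fin ν => ℓ.1) (fun ℓ => ℓ.1.shift ℓ.2) R) κ S₀)) T 0 c (fun i => (ω i : E)))) ^ 2
        ∂Measure.pi (fun _ : Site ν L => uniformSphere (volume : Measure E)) := by
  have h1 := torusLink_sublattice_sq_integral_loWeight_pow_le hL hLsq R hd κ S₀ hc0 hc he m hg i₀ hs4 (T := T) zero_le_one
  simpa only [one_mul, one_pow] using h1

end Torus

end Summit.Ventures.LatticeQCDFlow.Exactness

end
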